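import Summits.QuantumFields.YangMills.Theorems.LuscherReductionTwistedTraceScalingToronOrbitSpectrum
import Summits.QuantumFields.YangMills.Theorems.LuscherReductionTwistedTraceScalingToronAdaptedFrame
import HarnessLib

/-!
# The CONSTANT (zero-momentum) modes of `LinkSpace L` as an invariant subspace of the covariant Hessian at `V_θ`, and an eigenframe of `‖D_{V_θ}·‖²`
# adapted to them (slow = constant modes, fast = the rest)
# (Born–Oppenheimer split of the COARSE lanes, crux `TwistedTraceScaling` stmt-QuantumFields-20203; design `pub/ym-fleet/ym-luscher-20007-p1/COARSE-DESIGN.md` §14)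

`constModes L` = the translation-invariant link 1-forms `v(x,i;a) = c(i,a)` (Lüscher's `𝔥 ⊗` colours, the nine modes carrying the one-site model).  Because the
constant abelian background `V_θ` is translation invariant, the covariant Hessian `T_θ = D_{V_θ}†D_{V_θ}` COMMUTES with lattice translations
(★ `covHessian_abelianCfg_shiftLink`, from `…ToronOrbitSpectrum.covCurl_shiftCfg` and the unitarity of translations), so `constModes` is `T_θ`-invariant
(`covHessian_abelianCfg_mem_constModes`) and `…ToronAdaptedFrame.exists_isDiag_adapted` yields ★★ `exists_isDiag_adapted_constModes`: an orthonormal eigenframe of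
`‖D_{V_θ}·‖²` every vector of which is a constant mode or orthogonal to all of them — the frame the windowed harmonic step
(`Literature.…GaussianTransferKernelWindow`) wants, with slow window = constants.  Left for the successor: the slow values are `(0,0,0)` (neutral) and
`(0, ‖q̂₀(2θ)‖², ‖q̂₀(2θ)‖²) × 2` (charged), i.e. `Σ_slow modeZPE = 4·zeroModeZPE κ (2θ)` (`…ToronZeroMode`), by frame independence inside `constModes`.

HONEST FRAMING: fixed-lattice linear algebra; femto rung R2b1 (brick for a stub of a child of a CONDITIONAL route); not a gap, not Clay.
-/

set_option autoImplicit false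

noncomputable section

open Finset Module
open scoped BigOperators InnerProductSpace RealInnerProductSpace
open Literature.MathematicalPhysics.QuantumFieldTheory
open Literature.MathematicalPhysics.QuantumLattice

namespace Summit.QuantumFields.YangMills.Theorems.FemtoTransferGap.TwoLattice.Toron

open Summit.QuantumFields.YangMills.Theorems.FemtoTransferGap
open Summit.QuantumFields.YangMills.Theorems.FemtoTransferGap.TwoLattice
open Summit.QuantumFields.YangMills.Theorems.FemtoTransferGap.TwoLattice.Cov
open Summit.QuantumFields.YangMills.Theorems.FemtoTransferGap.TwoLattice.Stiff

variable (L : ℕ) [NeZero L]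

/-! ## §1 Translations as linear isometries; the constant modes -/

omit [NeZero L] in
/-- Translations are additive. [folklore] -/
theorem shiftLink_add (y : Site 3 L) (v w : LinkSpace L) : shiftLink L y (v + w) = shiftLink L y v + shiftLink L y w := by
  ext ⟨e, a⟩; rfl

omit [NeZero L] in
/-- Translations are homogeneous. [folklore] -/
theorem shiftLink_smul (y : Site 3 L) (c : ℝ) (v : LinkSpace L) : shiftLink L y (c • v) = c • shiftLink L y v := by
  ext ⟨e, a⟩; rfl

omit [NeZero L] in
/-- `τ_y ∘ τ_z = τ_{z + y}` on link forms. [folklore] -/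
theorem shiftLink_shiftLink (y z : Site 3 L) (v : LinkSpace L) : shiftLink L y (shiftLink L z v) = shiftLink L (z + y) v := by
  ext ⟨e, a⟩
  simp only [shiftLink_apply]
  rw [add_assoc, add_comm y z]

omit [NeZero L] in
/-- `τ_0 = id`. [folklore] -/
theorem shiftLink_zero (v : LinkSpace L) : shiftLink L 0 v = v := by
  ext ⟨e, a⟩; simp [shiftLink_apply]

omit [NeZero L] in
/-- The same for plaquette forms. [folklore] -/
theorem shiftPlaq_shiftPlaq (y z : Site 3 L) (F : PlaqSpace L) : shiftPlaq L y (shiftPlaq L z F) = shiftPlaq L (z + y) F := by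
  ext ⟨p, a⟩
  simp only [shiftPlaq_apply]
  rw [add_assoc, add_comm y z]

omit [NeZero L] in
/-- `τ'_0 = id`. [folklore] -/
theorem shiftPlaq_zero (F : PlaqSpace L) : shiftPlaq L 0 F = F := by
  ext ⟨p, a⟩; simp [shiftPlaq_apply]

/-- Adjoint of a translation: `⟪u, τ_y w⟫ = ⟪τ_{−y} u, w⟫`. [folklore] -/
theorem inner_shiftLink_right (y : Site 3 L) (u w : LinkSpace L) : ⟪u, shiftLink L y w⟫ = ⟪shiftLink L (-y) u, w⟫ := by
  rw [← inner_shiftLink L (-y) u (shiftLink L y w), shiftLink_shiftLink, add_neg_cancel, shiftLink_zero]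

/-- Adjoint of a translation on plaquette forms. [folklore] -/
theorem inner_shiftPlaq_right (y : Site 3 L) (F G : PlaqSpace L) : ⟪F, shiftPlaq L y G⟫ = ⟪shiftPlaq L (-y) F, G⟫ := by
  rw [← inner_shiftPlaq L (-y) F (shiftPlaq L y G), shiftPlaq_shiftPlaq, add_neg_cancel, shiftPlaq_zero]

/-- **The constant (translation-invariant, zero-momentum) modes** of `LinkSpace L`: `v(x + y, i; a) = v(x, i; a)` for all `y`. [cite: Luscher1983, §3] -/
def constModes : Submodule ℝ (LinkSpace L) where
  carrier := {v | ∀ y : Site 3 L, shiftLink L y v = v}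
  add_mem' {v w} hv hw := fun y => by rw [shiftLink_add, hv y, hw y]
  zero_mem' := fun y => by ext ⟨e, a⟩; rfl
  smul_mem' c {v} hv := fun y => by rw [shiftLink_smul, hv y]

omit [NeZero L] in
/-- Membership. [folklore] -/
theorem mem_constModes {v : LinkSpace L} : v ∈ constModes L ↔ ∀ y : Site 3 L, shiftLink L y v = v := Iff.rfl

omit [NeZero L] in
/-- A constant mode takes the same value at all sites: `v(x,i;a) = v(x',i;a)`. [folklore] -/
theorem apply_eq_of_mem_constModes {v : LinkSpace L} (hv : v ∈ constModes L) (x x' : Site 3 L) (i a : Fin 3) :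
    v ((x, i), a) = v ((x', i), a) := by
  have h := congrArg (fun u : LinkSpace L => u ((x', i), a)) (hv (x - x'))
  simp only [shiftLink_apply] at h
  rw [add_sub_cancel] at h
  exact h

/-! ## §2 The covariant Hessian at `V_θ` commutes with translations -/

/-- ★ **Translation invariance of the covariant Hessian's form at `V_θ`**: `⟪D_θ u, D_θ(τ_y w)⟫ = ⟪D_θ(τ_{−y} u), D_θ w⟫`. [cite: Luscher1983, §3] -/
theorem inner_covCurl_abelianCfg_shiftLink (θ : Fin 3 → ℝ) (y : Site 3 L) (u w : LinkSpace L) :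
    ⟪covCurl (abelianCfg L θ) u, covCurl (abelianCfg L θ) (shiftLink L y w)⟫ =
      ⟪covCurl (abelianCfg L θ) (shiftLink L (-y) u), covCurl (abelianCfg L θ) w⟫ := by
  have h1 : covCurl (abelianCfg L θ) (shiftLink L y w) = shiftPlaq L y (covCurl (abelianCfg L θ) w) := by
    rw [← covCurl_shiftCfg L y (abelianCfg L θ) w, shiftCfg_abelianCfg]
  have h2 : covCurl (abelianCfg L θ) (shiftLink L (-y) u) = shiftPlaq L (-y) (covCurl (abelianCfg L θ) u) := by
    rw [← covCurl_shiftCfg L (-y) (abelianCfg L θ) u, shiftCfg_abelianCfg]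
  rw [h1, h2, inner_shiftPlaq_right]

/-- ★ **`D_θ†D_θ` commutes with translations**: `T_θ (τ_y w) = τ_y (T_θ w)`. [cite: Luscher1983, §3] -/
theorem covHessian_abelianCfg_shiftLink (θ : Fin 3 → ℝ) (y : Site 3 L) (w : LinkSpace L) :
    ((covCurl (abelianCfg L θ)).adjoint ∘ₗ covCurl (abelianCfg L θ)) (shiftLink L y w) =
      shiftLink L y (((covCurl (abelianCfg L θ)).adjoint ∘ₗ covCurl (abelianCfg L θ)) w) := by
  refine ext_inner_left ℝ fun u => ?_
  rw [LinearMap.comp_apply, LinearMap.adjoint_inner_right, inner_covCurl_abelianCfg_shiftLink, inner_shiftLink_right,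
    LinearMap.comp_apply, LinearMap.adjoint_inner_right]

/-! ## §3 The constant modes are invariant; the adapted eigenframe -/

/-- The constant modes are invariant under the covariant Hessian at every constant abelian background. [cite: Luscher1983, §3] -/
theorem covHessian_abelianCfg_mem_constModes (θ : Fin 3 → ℝ) {v : LinkSpace L} (hv : v ∈ constModes L) :
    (covCurl (abelianCfg L θ)).adjoint (covCurl (abelianCfg L θ) v) ∈ constModes L := fun y => by
  have h := covHessian_abelianCfg_shiftLink L θ y v
  rw [LinearMap.comp_apply, LinearMap.comp_apply, hv y] at h
  exact h.symm

/-- ★★ **ADAPTED EIGENFRAME AT `V_θ`**: there is an orthonormal frame diagonalising `‖D_{V_θ}·‖²` whose every vector is a constant mode or orthogonal to all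
constant modes (slow/fast split for the Born–Oppenheimer treatment of the valley and the inner region). [cite: Luscher1983, §3] -/
theorem exists_isDiag_adapted_constModes (θ : Fin 3 → ℝ) :
    ∃ (n : ℕ) (e : OrthonormalBasis (Fin n) ℝ (LinkSpace L)),
      Frame.IsDiag (covCurl (abelianCfg L θ)) e (fun i => ‖covCurl (abelianCfg L θ) (e i)‖ ^ 2) ∧
        ∀ i, e i ∈ constModes L ∨ e i ∈ (constModes L)ᗮ :=
  Frame.exists_isDiag_adapted (covCurl (abelianCfg L θ)) (constModes L) fun _ hv => covHessian_abelianCfg_mem_constModes L θ hv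

/-- In such a frame the zero-point sum is still the toron sum (frame independence), now SPLIT over slow and fast vectors by any window predicate. [cite: Luscher1983, §3] -/
theorem sum_modeZPE_adapted (θ : Fin 3 → ℝ) {n : ℕ} {e : OrthonormalBasis (Fin n) ℝ (LinkSpace L)}
    (h : Frame.IsDiag (covCurl (abelianCfg L θ)) e (fun i => ‖covCurl (abelianCfg L θ) (e i)‖ ^ 2)) (κ : ℝ) (p : Fin n → Prop) [DecidablePred p] :
    ∑ i : {i // p i}, modeZPE (κ * ‖covCurl (abelianCfg L θ) (e i)‖ ^ 2) + ∑ i : {i // ¬p i}, modeZPE (κ * ‖covCurl (abelianCfg L θ) (e i)‖ ^ 2) =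
      2 * toronZPE L κ 0 0 + 4 * toronZPE L κ 0 (fun k => 2 * θ k) := by
  rw [Fintype.sum_subtype_add_sum_subtype p (fun i => modeZPE (κ * ‖covCurl (abelianCfg L θ) (e i)‖ ^ 2))]
  exact sum_modeZPE_of_isDiag_covCurl_abelianCfg L θ h κ

omit [NeZero L] in
/-- Constant modes that are NEUTRAL are zero modes (they are tangent to the flat valley); in an adapted frame the slow neutral vectors carry no zero-point energy.
[cite: Luscher1983, §3] -/
theorem covCurl_abelianCfg_eq_zero_of_mem_constModes_of_neutral (θ : Fin 3 → ℝ) {v : LinkSpace L} (hv : v ∈ constModes L)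
    (hneutral : ∀ e : Edge 3 L, v (e, 1) = 0 ∧ v (e, 2) = 0) : covCurl (abelianCfg L θ) v = 0 := by
  ext ⟨⟨x, kl⟩, a⟩
  rw [covCurl_abelianCfg_apply]
  obtain ⟨r00, r01, r02, r10, r20, -, -, -, -⟩ := chargedRot_entries (2 * θ kl.1.1)
  obtain ⟨s00, s01, s02, s10, s20, -, -, -, -⟩ := chargedRot_entries (2 * θ kl.1.2)
  have hc1 := apply_eq_of_mem_constModes L hv (x.shift kl.1.1) x kl.1.2
  have hc2 := apply_eq_of_mem_constModes L hv (x.shift kl.1.2) x kl.1.1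
  fin_cases a
  · simp [Fin.sum_univ_three, r00, r01, r02, s00, s01, s02, hc1 0, hc2 0, (hneutral _).1, (hneutral _).2]
  · simp [Fin.sum_univ_three, r10, s10, (hneutral _).1, (hneutral _).2]
  · simp [Fin.sum_univ_three, r20, s20, (hneutral _).1, (hneutral _).2]

end Summit.QuantumFields.YangMills.Theorems.FemtoTransferGap.TwoLattice.Toron

end
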